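import Summits.CriticalPhenomena.PercolationContinuityZ3.Theorems.PercNearOneGluingNoHeavyLowerTailAttachedChampionLevelOne
import HarnessLib

/-!
# `NoHeavyLowerTail` (stmt-CriticalPhenomena-4575) — the SHARPENED GUARDED CAUCHY–SCHWARZ LAW (STCS2) at LEVEL ONE

Support file (lemma factory #8 `prim-lf-8`, technique "tie/glue-locus exclusion", gen 4; `--supports
stmt-CriticalPhenomena-4575`).  No definitions, no named facts, no sorries.

`μ = prodBernoulli w` on `Fin n`, relays `A`, observer `o`, `N = |{a ∈ A : o ↔ a}|`, `D_a = {a ↮ A ∖ a}`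
(`= {|π(a)| ≤ 1}`, the level-1 lightness event), `S_a = μ(D_a)`.  The ttrl2 census `run/shared/lean/ttrl/tcs/README.md`
found the sharpened T-form law **STCS2** `S_c · μ(o ↮ c, 1 ≤ N ≤ j) ≤ S₂ · μ(o ↮ c, 1 ≤ N, |π(c)| ≤ j)`
(`c` a champion, `S₂` the runner-up lightness) violation-free in 8.98 M unique-champion pairs; the typed reduction
`Theorems.noHeavyLowerTail_of_sharpTCS` (…SharpTCSReduction.lean) shows that STCS2 at single observers closes the crux
(STCS2 ⇒ QP ⇒ QG ⇒ CIL).  This file PROVES the level `j = 1` for every `|A|` and every weighted graph, and in fact for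
EVERY relay `c` (no champion hypothesis) with the runner-up bound `t ≥ max_{a ≠ c} S_a`:

* `SharpTCSOne.sharpTCS_one_of_pairSep_pos` — the chain for a non-null separation event;
* `SharpTCSOne.sharpTCS_one_events` — unconditional, event vocabulary:
  `μ({o ↮ c} ∩ {N = 1}) · μ(D_c) ≤ t · μ(D_c ∩ ⋃_{a ∈ A∖c} {o ↔ a})`;
* `sharpTCS_one` — the same in the binder vocabulary of `noHeavyLowerTail_of_sharpTCS` at `j = 1`:
  `μ({o ↮ c} ∩ {1 ≤ N ≤ 1}) · μ(|π(c)| ≤ 1) ≤ μ({o ↮ c} ∩ {1 ≤ N ∧ |π(c)| ≤ 1}) · t`.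

Proof = the level-one chain of `AttachedChampionLevelOne.level_one_of_pairSep_pos` (lead, p-landed) with the
champion comparison replaced by the runner-up bound and the factor `μ(D_c)` kept: cover
`{o ↮ c, N = 1} ⊆ ⋃_{a ≠ c} {o ↔ a} ∩ D_a`; terminal separation (BHK 2006 Thm 1.3, `stub_terminalSeparation`)
`μ({o↔a} ∩ D_a) μ(Sep) ≤ μ(D_a) μ({o↔a} ∩ Sep)`; `μ(D_a) ≤ t`; disjointness of `{o ↔ a} ∩ Sep` over `a`; and the
set-BHK step `AttachedChampionLevelOne.sep_touch_negCorr` `μ(D_c) μ(U ∩ Sep) ≤ μ(D_c ∩ U) μ(Sep)`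
(`U = {o ↔ A∖c}`); divide by `μ(Sep) > 0`, the null case removed by scaling the weights (`stub_weightContinuity`).
Equality locus (census): championship tie or `o` glued to the champion — the runner-up weight `t` is exactly
the strictness of the T-form CIL off the tie locus, at level one.
-/

noncomputable section

namespace Summit.CriticalPhenomena.PercolationContinuityZ3.Theorems

open MeasureTheory Set Filter Topology Literature.Probability.LatticeModels Literature.Probability.Percolation
open scoped Classical BigOperators Topology

namespace SharpTCSOne

open AttachedChampionLevelOne

variable {n : ℕ}

/-- **Cover off the witness.**  If `o ↮ c` and exactly one relay is joined to `o`, then for some relay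
`a ≠ c`: `o ↔ a` and `a` is joined to no other relay. [folklore] -/
theorem compl_inter_cardOne_subset (A : Finset (Fin n)) (o c : Fin n) :
    (openConn o c : Set (BondConfig (Fin n)))ᶜ ∩
        {ω : Set (Sym2 (Fin n)) | (A.filter fun a => ω ∈ openConn o a).card = 1} ⊆
      ⋃ a ∈ A.erase c, (openConn o a ∩ {ω | ∀ t ∈ A.erase a, ω ∉ openConn a t}) := by
  rintro ω ⟨hoc, hcard⟩
  have h := lonelyRelay_subset_biUnion A o hcard
  rw [Set.mem_iUnion₂] at h
  obtain ⟨a, haA, hoa, hD⟩ := h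
  have hac : a ≠ c := by
    rintro rfl
    exact hoc hoa
  exact Set.mem_iUnion₂.2 ⟨a, Finset.mem_erase.2 ⟨hac, haA⟩, hoa, hD⟩

/-- **The level-one STCS2 chain with a non-null separation event.**  Terminal separation `hTS`
(= BHK 2006 Thm 1.3, discharged below), `c ∈ A`, `0 ≤ t`, `μ(D_a) ≤ t` for all `a ∈ A ∖ c`, and `μ(Sep) > 0`
give `μ({o ↮ c} ∩ {N = 1}) · μ(D_c) ≤ t · μ(D_c ∩ ⋃_{a ∈ A∖c} {o ↔ a})`.
[cite: KozmaNitzan2024, Lemma 1(i) + Lemma 2 (pp. 5–6); VandenbergHaggstromKahn2005, Thm. 1.3 (p. 6) — corollary] -/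
theorem sharpTCS_one_of_pairSep_pos
    (hTS : ∀ (n : ℕ) (w : Sym2 (Fin n) → unitInterval) (T : Finset (Fin n)) (o a : Fin n),
      (prodBernoulli w).real (openConn o a ∩ {ω | ∀ t ∈ T, ω ∉ openConn a t}) *
        (prodBernoulli w).real ({ω | ∀ t ∈ T, ω ∉ openConn a t} ∩
            {ω | ∀ t ∈ T, ∀ t' ∈ T, t ≠ t' → ω ∉ openConn t t'}) ≤
      (prodBernoulli w).real {ω | ∀ t ∈ T, ω ∉ openConn a t} *
        (prodBernoulli w).real (openConn o a ∩ ({ω | ∀ t ∈ T, ω ∉ openConn a t} ∩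
              {ω | ∀ t ∈ T, ∀ t' ∈ T, t ≠ t' → ω ∉ openConn t t'})))
    (w : Sym2 (Fin n) → unitInterval) (A : Finset (Fin n)) (o c : Fin n) (t : ℝ)
    (ht : 0 ≤ t) (hc : c ∈ A)
    (hru : ∀ a ∈ A, a ≠ c → (prodBernoulli w).real {ω | ∀ t ∈ A.erase a, ω ∉ openConn a t} ≤ t)
    (hM : 0 < (prodBernoulli w).real
      {ω : Set (Sym2 (Fin n)) | ∀ x ∈ A, ∀ y ∈ A, x ≠ y → ω ∉ openConn x y}) :
    (prodBernoulli w).real ((openConn o c : Set (BondConfig (Fin n)))ᶜ ∩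
          {ω : Set (Sym2 (Fin n)) | (A.filter fun a => ω ∈ openConn o a).card = 1}) *
        (prodBernoulli w).real {ω | ∀ t ∈ A.erase c, ω ∉ openConn c t} ≤
      t * (prodBernoulli w).real ({ω | ∀ t ∈ A.erase c, ω ∉ openConn c t} ∩
          ⋃ a ∈ A.erase c, openConn o a) := by
  set μ := prodBernoulli w with hμ
  set Sep : Set (Set (Sym2 (Fin n))) := {ω | ∀ x ∈ A, ∀ y ∈ A, x ≠ y → ω ∉ openConn x y} with hSep
  set Dc : Set (Set (Sym2 (Fin n))) := {ω | ∀ t ∈ A.erase c, ω ∉ openConn c t} with hDc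
  set U : Set (Set (Sym2 (Fin n))) := ⋃ a ∈ A.erase c, openConn o a with hU
  have hmeas : ∀ s : Set (Set (Sym2 (Fin n))), MeasurableSet s := fun _ => MeasurableSet.of_discrete
  -- (1) cover and union bound
  have h1 : μ.real ((openConn o c : Set (BondConfig (Fin n)))ᶜ ∩
      {ω : Set (Sym2 (Fin n)) | (A.filter fun a => ω ∈ openConn o a).card = 1}) ≤
      ∑ a ∈ A.erase c, μ.real (openConn o a ∩ {ω | ∀ t ∈ A.erase a, ω ∉ openConn a t}) :=
    (measureReal_mono (compl_inter_cardOne_subset A o c) (measure_ne_top μ _)).trans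
      (measureReal_biUnion_finset_le (A.erase c)
        (fun a => openConn o a ∩ {ω : Set (Sym2 (Fin n)) | ∀ t ∈ A.erase a, ω ∉ openConn a t}))
  -- (2) terminal separation + runner-up bound, term by term for `a ≠ c`
  have h2 : ∀ a ∈ A.erase c,
      μ.real (openConn o a ∩ {ω | ∀ t ∈ A.erase a, ω ∉ openConn a t}) * μ.real Sep ≤
        t * μ.real (openConn o a ∩ Sep) := by
    intro a ha
    obtain ⟨hac, haA⟩ := Finset.mem_erase.1 ha
    have key := hTS n w (A.erase a) o a
    rw [singleFinger_sep_inter_pairSep_eq A haA] at key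
    exact key.trans (mul_le_mul_of_nonneg_right (hru a haA hac) measureReal_nonneg)
  -- (3) disjointness of `{o ↔ a} ∩ Sep` over `a ≠ c`
  have h3 : ∑ a ∈ A.erase c, μ.real (openConn o a ∩ Sep) = μ.real (U ∩ Sep) := by
    rw [hU, Set.iUnion₂_inter]
    exact (measureReal_biUnion_finset
      (singleFinger_pairwiseDisjoint_conn_inter_pairSep A (A.erase c) o (Finset.erase_subset c A))
      (fun a _ => hmeas _)).symm
  have h23 : (∑ a ∈ A.erase c, μ.real (openConn o a ∩ {ω | ∀ t ∈ A.erase a, ω ∉ openConn a t})) *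
      μ.real Sep ≤ t * μ.real (U ∩ Sep) := by
    rw [Finset.sum_mul]
    calc ∑ a ∈ A.erase c, μ.real (openConn o a ∩ {ω | ∀ t ∈ A.erase a, ω ∉ openConn a t}) * μ.real Sep
        ≤ ∑ a ∈ A.erase c, t * μ.real (openConn o a ∩ Sep) := Finset.sum_le_sum h2
      _ = t * μ.real (U ∩ Sep) := by rw [← Finset.mul_sum, h3]
  -- (4) the set-BHK step: `μ(D_c) μ(U ∩ Sep) ≤ μ(D_c ∩ U) μ(Sep)`
  have h4 : μ.real Dc * μ.real (U ∩ Sep) ≤ μ.real (Dc ∩ U) * μ.real Sep := by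
    have key := sep_touch_negCorr w (A.erase c) c o
    have hSepEq : Dc ∩ {ω : Set (Sym2 (Fin n)) | ∀ t ∈ A.erase c, ∀ t' ∈ A.erase c, t ≠ t' → ω ∉ openConn t t'}
        = Sep := by
      rw [hDc, hSep]; exact singleFinger_sep_inter_pairSep_eq A hc
    have hUS : Dc ∩ (U ∩ {ω : Set (Sym2 (Fin n)) | ∀ t ∈ A.erase c, ∀ t' ∈ A.erase c, t ≠ t' →
        ω ∉ openConn t t'}) = U ∩ Sep := by
      rw [← hSepEq, ← Set.inter_assoc, Set.inter_comm Dc U, Set.inter_assoc]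
    rw [hUS, hSepEq] at key
    exact key
  -- (5) multiply (1)+(2)+(3) by `μ(D_c)`, use (4), divide by `μ(Sep) > 0`
  have hDc0 : 0 ≤ μ.real Dc := measureReal_nonneg
  have h5 : (∑ a ∈ A.erase c, μ.real (openConn o a ∩ {ω | ∀ t ∈ A.erase a, ω ∉ openConn a t})) *
      μ.real Dc * μ.real Sep ≤ (t * μ.real (Dc ∩ U)) * μ.real Sep := by
    calc (∑ a ∈ A.erase c, μ.real (openConn o a ∩ {ω | ∀ t ∈ A.erase a, ω ∉ openConn a t})) *
          μ.real Dc * μ.real Sep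
        = ((∑ a ∈ A.erase c, μ.real (openConn o a ∩ {ω | ∀ t ∈ A.erase a, ω ∉ openConn a t})) *
            μ.real Sep) * μ.real Dc := by ring
      _ ≤ (t * μ.real (U ∩ Sep)) * μ.real Dc := mul_le_mul_of_nonneg_right h23 hDc0
      _ = t * (μ.real Dc * μ.real (U ∩ Sep)) := by ring
      _ ≤ t * (μ.real (Dc ∩ U) * μ.real Sep) := mul_le_mul_of_nonneg_left h4 ht
      _ = (t * μ.real (Dc ∩ U)) * μ.real Sep := by ring
  have h6 : (∑ a ∈ A.erase c, μ.real (openConn o a ∩ {ω | ∀ t ∈ A.erase a, ω ∉ openConn a t})) *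
      μ.real Dc ≤ t * μ.real (Dc ∩ U) := le_of_mul_le_mul_right h5 hM
  exact (mul_le_mul_of_nonneg_right h1 hDc0).trans h6

/-- **Removing the null case by scaling the weights** (as in `AttachedChampionLevelOne.level_one_of_terminalSeparation`):
for every weight function, `c ∈ A`, `0 ≤ t` and `μ(D_a) ≤ t` for all `a ∈ A ∖ c` give
`μ({o ↮ c} ∩ {N = 1}) · μ(D_c) ≤ t · μ(D_c ∩ ⋃_{a ∈ A∖c} {o ↔ a})`.
[cite: KozmaNitzan2024, Lemma 1(i) + Lemma 2 (pp. 5–6); VandenbergHaggstromKahn2005, Thm. 1.3 (p. 6) — corollary] -/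
theorem sharpTCS_one_of_terminalSeparation
    (hTS : ∀ (n : ℕ) (w : Sym2 (Fin n) → unitInterval) (T : Finset (Fin n)) (o a : Fin n),
      (prodBernoulli w).real (openConn o a ∩ {ω | ∀ t ∈ T, ω ∉ openConn a t}) *
        (prodBernoulli w).real ({ω | ∀ t ∈ T, ω ∉ openConn a t} ∩
            {ω | ∀ t ∈ T, ∀ t' ∈ T, t ≠ t' → ω ∉ openConn t t'}) ≤
      (prodBernoulli w).real {ω | ∀ t ∈ T, ω ∉ openConn a t} *
        (prodBernoulli w).real (openConn o a ∩ ({ω | ∀ t ∈ T, ω ∉ openConn a t} ∩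
              {ω | ∀ t ∈ T, ∀ t' ∈ T, t ≠ t' → ω ∉ openConn t t'})))
    (hcont : ∀ (n : ℕ) (E : Set (BondConfig (Fin n))),
      Continuous fun w : Sym2 (Fin n) → unitInterval => (prodBernoulli w).real E)
    (w : Sym2 (Fin n) → unitInterval) (A : Finset (Fin n)) (o c : Fin n) (t : ℝ)
    (ht : 0 ≤ t) (hc : c ∈ A)
    (hru : ∀ a ∈ A, a ≠ c → (prodBernoulli w).real {ω | ∀ t ∈ A.erase a, ω ∉ openConn a t} ≤ t) :
    (prodBernoulli w).real ((openConn o c : Set (BondConfig (Fin n)))ᶜ ∩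
          {ω : Set (Sym2 (Fin n)) | (A.filter fun a => ω ∈ openConn o a).card = 1}) *
        (prodBernoulli w).real {ω | ∀ t ∈ A.erase c, ω ∉ openConn c t} ≤
      t * (prodBernoulli w).real ({ω | ∀ t ∈ A.erase c, ω ∉ openConn c t} ∩
          ⋃ a ∈ A.erase c, openConn o a) := by
  -- scaled weights `w_k = (1 - 1/(k+1)) • w`, all `< 1`, converging to `w`
  have hcmem : ∀ k : ℕ, ((1 : ℝ) - 1 / ((k : ℝ) + 1)) ∈ unitInterval := by
    intro k
    have hk : (0 : ℝ) < (k : ℝ) + 1 := Nat.cast_add_one_pos k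
    have h1 : 1 / ((k : ℝ) + 1) ≤ 1 := by
      rw [div_le_one hk]; linarith [(Nat.cast_nonneg k : (0 : ℝ) ≤ k)]
    have h0 : 0 ≤ 1 / ((k : ℝ) + 1) := by positivity
    exact ⟨by linarith, by linarith⟩
  set wk : ℕ → Sym2 (Fin n) → unitInterval :=
    fun k e => ⟨(1 - 1 / ((k : ℝ) + 1)) * (w e : ℝ), unitInterval.mul_mem (hcmem k) (w e).2⟩
    with hwk_def
  have hwk_lt : ∀ k e, ((wk k e : unitInterval) : ℝ) < 1 := by
    intro k e
    have hk : (0 : ℝ) < (k : ℝ) + 1 := Nat.cast_add_one_pos k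
    have hc' : (1 : ℝ) - 1 / ((k : ℝ) + 1) < 1 := by
      have : 0 < 1 / ((k : ℝ) + 1) := by positivity
      linarith
    calc ((wk k e : unitInterval) : ℝ) = (1 - 1 / ((k : ℝ) + 1)) * (w e : ℝ) := rfl
      _ ≤ (1 - 1 / ((k : ℝ) + 1)) := mul_le_of_le_one_right (hcmem k).1 (w e).2.2
      _ < 1 := hc'
  have hc_lim : Tendsto (fun k : ℕ => (1 : ℝ) - 1 / ((k : ℝ) + 1)) atTop (𝓝 1) := by
    simpa using tendsto_const_nhds.sub (tendsto_one_div_add_atTop_nhds_zero_nat (𝕜 := ℝ))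
  have hwk_lim : Tendsto wk atTop (𝓝 w) := by
    refine tendsto_pi_nhds.2 fun e => ?_
    rw [tendsto_subtype_rng]
    have h := hc_lim.mul_const (w e : ℝ)
    rw [one_mul] at h
    exact h
  have hlimE : ∀ E : Set (Set (Sym2 (Fin n))),
      Tendsto (fun k => (prodBernoulli (wk k)).real E) atTop (𝓝 ((prodBernoulli w).real E)) :=
    fun E => ((hcont n E).tendsto w).comp hwk_lim
  -- error terms `δ k = ∑_{a ∈ A} |μ_{w_k}(D_a) - μ_w(D_a)| → 0`
  set δ : ℕ → ℝ := fun k => ∑ a ∈ A,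
      |(prodBernoulli (wk k)).real {ω | ∀ t ∈ A.erase a, ω ∉ openConn a t} -
        (prodBernoulli w).real {ω | ∀ t ∈ A.erase a, ω ∉ openConn a t}|
    with hδ_def
  have hδ0 : ∀ k, 0 ≤ δ k := fun k => Finset.sum_nonneg fun a _ => abs_nonneg _
  have hδ_lim : Tendsto δ atTop (𝓝 0) := by
    have h : ∀ a ∈ A, Tendsto (fun k =>
        |(prodBernoulli (wk k)).real {ω | ∀ t ∈ A.erase a, ω ∉ openConn a t} -
          (prodBernoulli w).real {ω | ∀ t ∈ A.erase a, ω ∉ openConn a t}|)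
        atTop (𝓝 0) := by
      intro a _
      simpa using (tendsto_sub_nhds_zero_iff.2
        (hlimE {ω | ∀ t ∈ A.erase a, ω ∉ openConn a t})).abs
    simpa [hδ_def] using tendsto_finsetSum A h
  have hδa : ∀ k, ∀ a ∈ A,
      |(prodBernoulli (wk k)).real {ω | ∀ t ∈ A.erase a, ω ∉ openConn a t} -
        (prodBernoulli w).real {ω | ∀ t ∈ A.erase a, ω ∉ openConn a t}| ≤ δ k := by
    intro k a ha
    exact Finset.single_le_sum (f := fun a =>
        |(prodBernoulli (wk k)).real {ω | ∀ t ∈ A.erase a, ω ∉ openConn a t} -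
          (prodBernoulli w).real {ω | ∀ t ∈ A.erase a, ω ∉ openConn a t}|)
      (fun a _ => abs_nonneg _) ha
  -- the bound at each `k`, with runner-up bound `t + δ k`
  have hk : ∀ k, (prodBernoulli (wk k)).real ((openConn o c : Set (BondConfig (Fin n)))ᶜ ∩
        {ω : Set (Sym2 (Fin n)) | (A.filter fun a => ω ∈ openConn o a).card = 1}) *
        (prodBernoulli (wk k)).real {ω | ∀ t ∈ A.erase c, ω ∉ openConn c t} ≤
      (t + δ k) * (prodBernoulli (wk k)).real ({ω | ∀ t ∈ A.erase c, ω ∉ openConn c t} ∩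
          ⋃ a ∈ A.erase c, openConn o a) := by
    intro k
    refine sharpTCS_one_of_pairSep_pos hTS (wk k) A o c (t + δ k) (by linarith [hδ0 k]) hc ?_
      (singleFinger_pairSep_real_pos (wk k) (hwk_lt k) _)
    intro a ha hac
    have h1 := hru a ha hac
    have h2 := (abs_sub_le_iff.1 (hδa k a ha)).1
    linarith
  -- pass to the limit
  have hlimL : Tendsto (fun k => (prodBernoulli (wk k)).real ((openConn o c : Set (BondConfig (Fin n)))ᶜ ∩
        {ω : Set (Sym2 (Fin n)) | (A.filter fun a => ω ∈ openConn o a).card = 1}) *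
        (prodBernoulli (wk k)).real {ω | ∀ t ∈ A.erase c, ω ∉ openConn c t}) atTop
      (𝓝 ((prodBernoulli w).real ((openConn o c : Set (BondConfig (Fin n)))ᶜ ∩
        {ω : Set (Sym2 (Fin n)) | (A.filter fun a => ω ∈ openConn o a).card = 1}) *
        (prodBernoulli w).real {ω | ∀ t ∈ A.erase c, ω ∉ openConn c t})) :=
    (hlimE _).mul (hlimE _)
  have hlimR : Tendsto (fun k => (t + δ k) * (prodBernoulli (wk k)).real
      ({ω | ∀ t ∈ A.erase c, ω ∉ openConn c t} ∩ ⋃ a ∈ A.erase c, openConn o a)) atTop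
      (𝓝 (t * (prodBernoulli w).real
        ({ω | ∀ t ∈ A.erase c, ω ∉ openConn c t} ∩ ⋃ a ∈ A.erase c, openConn o a))) := by
    have ht' : Tendsto (fun k => t + δ k) atTop (𝓝 t) := by
      simpa using tendsto_const_nhds.add hδ_lim
    exact ht'.mul (hlimE _)
  exact le_of_tendsto_of_tendsto' hlimL hlimR hk

/-- **STCS2 at level one, event vocabulary** (all `|A|`, every relay `c`, unconditional): for `c ∈ A`, `0 ≤ t`
and `μ(a ↮ A∖a) ≤ t` for all `a ∈ A ∖ c`,
  `μ({o ↮ c} ∩ {N = 1}) · μ(c ↮ A∖c) ≤ t · μ({c ↮ A∖c} ∩ ⋃_{a ∈ A∖c} {o ↔ a})`.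
[cite: KozmaNitzan2024, Lemma 1(i) + Lemma 2 (pp. 5–6); VandenbergHaggstromKahn2005, Thm. 1.3 (p. 6) — corollary] -/
theorem sharpTCS_one_events (w : Sym2 (Fin n) → unitInterval) (A : Finset (Fin n)) (o c : Fin n) (t : ℝ)
    (ht : 0 ≤ t) (hc : c ∈ A)
    (hru : ∀ a ∈ A, a ≠ c → (prodBernoulli w).real {ω | ∀ t ∈ A.erase a, ω ∉ openConn a t} ≤ t) :
    (prodBernoulli w).real ((openConn o c : Set (BondConfig (Fin n)))ᶜ ∩
          {ω : Set (Sym2 (Fin n)) | (A.filter fun a => ω ∈ openConn o a).card = 1}) *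
        (prodBernoulli w).real {ω | ∀ t ∈ A.erase c, ω ∉ openConn c t} ≤
      t * (prodBernoulli w).real ({ω | ∀ t ∈ A.erase c, ω ∉ openConn c t} ∩
          ⋃ a ∈ A.erase c, openConn o a) := by
  refine sharpTCS_one_of_terminalSeparation (stub_terminalSeparation ?_) stub_weightContinuity
    w A o c t ht hc hru
  intro n w s X F G hF hG hs
  exact BHK2006_clusterConditionalPositiveAssociation_holds (Fin n) w s X F G hF hG hs

/-- The right-hand event: `{o ↮ c} ∩ {1 ≤ N} ∩ {|π(c)| ≤ 1} ⊇ {c ↮ A∖c} ∩ ⋃_{a ≠ c} {o ↔ a}` (in fact `=`;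
only this inclusion is used). [folklore] -/
theorem sep_inter_biUnion_subset (A : Finset (Fin n)) (o : Fin n) {c : Fin n} (hc : c ∈ A) :
    {ω : Set (Sym2 (Fin n)) | ∀ t ∈ A.erase c, ω ∉ openConn c t} ∩ (⋃ a ∈ A.erase c, openConn o a) ⊆
      (openConn o c : Set (BondConfig (Fin n)))ᶜ ∩
        {ω | 1 ≤ (A.filter fun x => ω ∈ openConn o x).card ∧
          (A.filter fun x => ω ∈ openConn c x).card ≤ 1} := by
  rintro ω ⟨hD, hU⟩
  rw [Set.mem_iUnion₂] at hU
  obtain ⟨a, ha, hoa⟩ := hU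
  obtain ⟨hac, haA⟩ := Finset.mem_erase.1 ha
  have hoa' : (openGraph ω).Reachable o a := hoa
  refine ⟨?_, ?_, ?_⟩
  · intro hoc
    have hoc' : (openGraph ω).Reachable o c := hoc
    exact hD a ha (hoc'.symm.trans hoa')
  · have : {ω' : Set (Sym2 (Fin n)) | 1 ≤ (A.filter fun x => ω' ∈ openConn o x).card} ω := by
      rw [setOf_one_le_card_eq A o]
      exact Set.mem_iUnion₂.2 ⟨a, haA, hoa⟩
    exact this
  · have : {ω' : Set (Sym2 (Fin n)) | (A.filter fun x => ω' ∈ openConn c x).card ≤ 1} ω := by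
      rw [setOf_card_le_one_eq A hc]
      exact hD
    exact this

end SharpTCSOne

open SharpTCSOne AttachedChampionLevelOne in
/-- **STCS2 AT LEVEL ONE** — the `j = 1` instance of the hypothesis of `Theorems.noHeavyLowerTail_of_sharpTCS`,
for every weighted graph on `Fin n`, every relay set `A`, observer `o`, EVERY relay `c ∈ A` (no champion hypothesis
needed at level one) and every runner-up bound `t ≥ 0` with `μ(|π(a)| ≤ 1) ≤ t` for all relays `a ≠ c`:
  `μ({o ↮ c} ∩ {1 ≤ N ≤ 1}) · μ(|π(c)| ≤ 1) ≤ μ({o ↮ c} ∩ {1 ≤ N ∧ |π(c)| ≤ 1}) · t`.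
With `c` a champion and `t = S₂` this is the sharpened guarded Cauchy–Schwarz law STCS2 of the ttrl2 `tcs` census at
level one; it sharpens the lonely relay lemma (KN Lemma 2), its quantitative-gap form `quantGapOne` and the level-one
attached-champion inequality `attachedChampion_level_one` simultaneously (runner-up weight AND attachment guard).
[cite: KozmaNitzan2024, Lemma 1(i) + Lemma 2 (pp. 5–6); VandenbergHaggstromKahn2005, Thm. 1.3 (p. 6) — corollary] -/
theorem sharpTCS_one (n : ℕ) (w : Sym2 (Fin n) → unitInterval) (A : Finset (Fin n)) (o c : Fin n) (t : ℝ)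
    (hc : c ∈ A) (ht : 0 ≤ t)
    (hru : ∀ a ∈ A, a ≠ c →
      (prodBernoulli w).real {ω : BondConfig (Fin n) | (A.filter fun x => ω ∈ openConn a x).card ≤ 1} ≤ t) :
    (prodBernoulli w).real ((openConn o c : Set (BondConfig (Fin n)))ᶜ ∩
          {ω | 1 ≤ (A.filter fun x => ω ∈ openConn o x).card ∧
            (A.filter fun x => ω ∈ openConn o x).card ≤ 1}) *
        (prodBernoulli w).real {ω : BondConfig (Fin n) | (A.filter fun x => ω ∈ openConn c x).card ≤ 1} ≤
      (prodBernoulli w).real ((openConn o c : Set (BondConfig (Fin n)))ᶜ ∩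
          {ω | 1 ≤ (A.filter fun x => ω ∈ openConn o x).card ∧
            (A.filter fun x => ω ∈ openConn c x).card ≤ 1}) * t := by
  have hru' : ∀ a ∈ A, a ≠ c → (prodBernoulli w).real {ω | ∀ t ∈ A.erase a, ω ∉ openConn a t} ≤ t := by
    intro a ha hac
    have h := hru a ha hac
    rw [setOf_card_le_one_eq A ha] at h
    exact h
  have key := sharpTCS_one_events w A o c t ht hc hru'
  rw [← setOf_card_eq_one_eq A o, setOf_card_le_one_eq A hc]
  have hmono : (prodBernoulli w).real ({ω : Set (Sym2 (Fin n)) | ∀ t ∈ A.erase c, ω ∉ openConn c t} ∩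
      ⋃ a ∈ A.erase c, openConn o a) ≤
      (prodBernoulli w).real ((openConn o c : Set (BondConfig (Fin n)))ᶜ ∩
          {ω | 1 ≤ (A.filter fun x => ω ∈ openConn o x).card ∧
            (A.filter fun x => ω ∈ openConn c x).card ≤ 1}) :=
    measureReal_mono (sep_inter_biUnion_subset A o hc) (measure_ne_top _ _)
  calc (prodBernoulli w).real ((openConn o c : Set (BondConfig (Fin n)))ᶜ ∩
          {ω : Set (Sym2 (Fin n)) | (A.filter fun a => ω ∈ openConn o a).card = 1}) *
        (prodBernoulli w).real {ω | ∀ t ∈ A.erase c, ω ∉ openConn c t}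
      ≤ t * (prodBernoulli w).real ({ω | ∀ t ∈ A.erase c, ω ∉ openConn c t} ∩
          ⋃ a ∈ A.erase c, openConn o a) := key
    _ ≤ t * (prodBernoulli w).real ((openConn o c : Set (BondConfig (Fin n)))ᶜ ∩
          {ω | 1 ≤ (A.filter fun x => ω ∈ openConn o x).card ∧
            (A.filter fun x => ω ∈ openConn c x).card ≤ 1}) := mul_le_mul_of_nonneg_left hmono ht
    _ = _ := mul_comm _ _

end Summit.CriticalPhenomena.PercolationContinuityZ3.Theorems

end
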